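import Mathlib
import Summits.MatrixMultiplication.MatrixMultiplication.Theorems.SubgroupIdentityDesigns.Negative.WitnessPairBound

/-!
# Borel conjugation: a unitriangular-free upper-triangular subgroup is `U⁺`-conjugate
# to a diagonal one

Route `LevelGradedCohnUmans`, crux `SubgroupIdentityDesigns`, the `(m,k) = (2,1)` cell.

Let `E ≤ B⁺ ≤ GL₂(𝔽_p)` be a subgroup of upper-triangular matrices containing no unitriangular
element except `1` (e.g. `E = S ∩ B⁺` for a member `S` of a TPP triple whose first member contains
`U⁺`).  Then (`exists_unitri_conj_diag`) there is a unitriangular `u = [[1,t],[0,1]]` with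
`u E u⁻¹` DIAGONAL.  Ingredients, all elementary and valid for every prime `p`:
* powers of an upper-triangular element with equal diagonal entries (`pow_entries_of_eqdiag`) and
  Fermat: such an element of `E` is diagonal (`offdiag_eq_zero_of_eqdiag`, via `e^{p-1}`
  unitriangular);
* `E` is commutative (`comm_of_unitri_free`: `cb(bc)⁻¹` is unitriangular);
* an upper-triangular matrix commuting with a diagonal matrix with distinct entries is diagonal
  (`offdiag_eq_zero_of_comm_diag`); the conjugation formula `conj_entries_of_upper`.
This is the tool that feeds the torus budget (`TorusBudget.torus_budget`, which wants a DIAGONAL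
subgroup of the middle member) in the placements `(U⁺T₁, S, U⁻T₂)` and `(U⁺T₁, S₂, S₃)`.

VALUE = THEOREM (all `p`), NOT summit progress; the crux item stmt-MatrixMultiplication-14079 is
untouched and remains open.
-/

set_option linter.dupNamespace false

noncomputable section

open scoped BigOperators Classical

open Summit.MatrixMultiplication.MatrixMultiplication.Theorems.LieRankDesigns.Negative (GLm Mat)

namespace Summit.MatrixMultiplication.MatrixMultiplication.Theorems.SubgroupIdentityDesigns.Negative

section BorelConjugation

variable {p : ℕ} [hp : Fact p.Prime]

/-- Powers of an upper-triangular element `e` with equal diagonal entries `α`: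
`e^n` is upper-triangular with diagonal `αⁿ` and `(e^n)₀₁·α = n·αⁿ·e₀₁`. -/
theorem pow_entries_of_eqdiag (e : GLm p 2) (h10 : (e : Mat p 2) 1 0 = 0)
    (hd : (e : Mat p 2) 0 0 = (e : Mat p 2) 1 1) (n : ℕ) :
    ((e ^ n : GLm p 2) : Mat p 2) 1 0 = 0 ∧
    ((e ^ n : GLm p 2) : Mat p 2) 0 0 = (e : Mat p 2) 0 0 ^ n ∧
    ((e ^ n : GLm p 2) : Mat p 2) 1 1 = (e : Mat p 2) 0 0 ^ n ∧
    ((e ^ n : GLm p 2) : Mat p 2) 0 1 * (e : Mat p 2) 0 0 =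
      n * (e : Mat p 2) 0 0 ^ n * (e : Mat p 2) 0 1 := by
  induction n with
  | zero => simp
  | succ n ih =>
    obtain ⟨i10, i00, i11, i01⟩ := ih
    have m : ∀ i j, ((e ^ (n + 1) : GLm p 2) : Mat p 2) i j =
        ((e ^ n : GLm p 2) : Mat p 2) i 0 * (e : Mat p 2) 0 j +
          ((e ^ n : GLm p 2) : Mat p 2) i 1 * (e : Mat p 2) 1 j := by
      intro i j
      rw [pow_succ, Units.val_mul, Matrix.mul_apply, Fin.sum_univ_two]
    refine ⟨?_, ?_, ?_, ?_⟩
    · rw [m, i10, h10, zero_mul, mul_zero, add_zero]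
    · rw [m, i00, h10, mul_zero, add_zero, pow_succ]
    · rw [m, i10, zero_mul, zero_add, i11, ← hd, pow_succ]
    · rw [m, i00, ← hd]
      push_cast
      linear_combination (e : Mat p 2) 0 0 * i01

/-- In an upper-triangular subgroup `E` with no unitriangular element except `1`, every element
with equal diagonal entries is diagonal (`e^{p-1}` is unitriangular by Fermat, hence `1`, and
`(e^{p-1})₀₁·α = (p-1)·e₀₁`). -/
theorem offdiag_eq_zero_of_eqdiag {E : Subgroup (GLm p 2)}
    (hE1 : ∀ v ∈ E, (v : Mat p 2) 1 0 = 0 → (v : Mat p 2) 0 0 = 1 → (v : Mat p 2) 1 1 = 1 →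
      v = 1)
    {e : GLm p 2} (he : e ∈ E) (h10 : (e : Mat p 2) 1 0 = 0)
    (hd : (e : Mat p 2) 0 0 = (e : Mat p 2) 1 1) : (e : Mat p 2) 0 1 = 0 := by
  have hα : (e : Mat p 2) 0 0 ≠ 0 := (diag_ne_zero_of_upper h10).1
  obtain ⟨q10, q00, q11, q01⟩ := pow_entries_of_eqdiag e h10 hd (p - 1)
  rw [ZMod.pow_card_sub_one_eq_one hα] at q00 q11 q01
  have h1 : e ^ (p - 1) = 1 := hE1 _ (E.pow_mem he _) q10 q00 q11
  rw [h1] at q01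
  have h0 : ((p - 1 : ℕ) : ZMod p) * (e : Mat p 2) 0 1 = 0 := by
    rw [mul_one] at q01
    rw [← q01]
    simp
  have hp1 : ((p - 1 : ℕ) : ZMod p) ≠ 0 := by
    rw [Ne, ZMod.natCast_eq_zero_iff]
    intro h
    have h2 := hp.out.two_le
    have := Nat.le_of_dvd (by omega) h
    omega
  exact (mul_eq_zero.mp h0).resolve_left hp1

/-- Elements of an upper-triangular subgroup with no unitriangular element except `1` commute:
`v = c b (b c)⁻¹` satisfies `v (b c) = c b` with both products upper-triangular of the same
diagonal, so `v` is unitriangular. -/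
theorem comm_of_unitri_free {E : Subgroup (GLm p 2)} (hE : ∀ e ∈ E, (e : Mat p 2) 1 0 = 0)
    (hE1 : ∀ v ∈ E, (v : Mat p 2) 1 0 = 0 → (v : Mat p 2) 0 0 = 1 → (v : Mat p 2) 1 1 = 1 →
      v = 1)
    {b c : GLm p 2} (hb : b ∈ E) (hc : c ∈ E) : b * c = c * b := by
  have hb10 := hE b hb
  have hc10 := hE c hc
  have hv : c * b * (b * c)⁻¹ ∈ E :=
    E.mul_mem (E.mul_mem hc hb) (E.inv_mem (E.mul_mem hb hc))
  have hPd := diag_ne_zero_of_upper (hE _ (E.mul_mem hb hc))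
  -- entries of `v * (b c) = c b`
  have key : ∀ i j, ((c * b : GLm p 2) : Mat p 2) i j =
      ((c * b * (b * c)⁻¹ : GLm p 2) : Mat p 2) i 0 * ((b * c : GLm p 2) : Mat p 2) 0 j +
        ((c * b * (b * c)⁻¹ : GLm p 2) : Mat p 2) i 1 * ((b * c : GLm p 2) : Mat p 2) 1 j := by
    intro i j
    conv_lhs => rw [show c * b = c * b * (b * c)⁻¹ * (b * c) by group]
    rw [Units.val_mul (c * b * (b * c)⁻¹), Matrix.mul_apply, Fin.sum_univ_two]
  have bc00 : ((b * c : GLm p 2) : Mat p 2) 0 0 = (b : Mat p 2) 0 0 * (c : Mat p 2) 0 0 := by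
    simp [Units.val_mul, Matrix.mul_apply, Fin.sum_univ_two, hc10]
  have bc11 : ((b * c : GLm p 2) : Mat p 2) 1 1 = (b : Mat p 2) 1 1 * (c : Mat p 2) 1 1 := by
    simp [Units.val_mul, Matrix.mul_apply, Fin.sum_univ_two, hb10]
  have cb00 : ((c * b : GLm p 2) : Mat p 2) 0 0 = (b : Mat p 2) 0 0 * (c : Mat p 2) 0 0 := by
    simp [Units.val_mul, Matrix.mul_apply, Fin.sum_univ_two, hb10, mul_comm]
  have cb11 : ((c * b : GLm p 2) : Mat p 2) 1 1 = (b : Mat p 2) 1 1 * (c : Mat p 2) 1 1 := by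
    simp [Units.val_mul, Matrix.mul_apply, Fin.sum_univ_two, hc10, mul_comm]
  have cb10 : ((c * b : GLm p 2) : Mat p 2) 1 0 = 0 := hE _ (E.mul_mem hc hb)
  have bc10 : ((b * c : GLm p 2) : Mat p 2) 1 0 = 0 := hE _ (E.mul_mem hb hc)
  have v10 : ((c * b * (b * c)⁻¹ : GLm p 2) : Mat p 2) 1 0 = 0 := by
    have e := key 1 0
    rw [cb10, bc10, mul_zero, add_zero] at e
    exact (mul_eq_zero.mp e.symm).resolve_right hPd.1
  have v00 : ((c * b * (b * c)⁻¹ : GLm p 2) : Mat p 2) 0 0 = 1 := by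
    have e := key 0 0
    rw [bc10, mul_zero, add_zero, cb00, ← bc00] at e
    exact (mul_eq_right₀ hPd.1).mp e.symm
  have v11 : ((c * b * (b * c)⁻¹ : GLm p 2) : Mat p 2) 1 1 = 1 := by
    have e := key 1 1
    rw [v10, zero_mul, zero_add, cb11, ← bc11] at e
    exact (mul_eq_right₀ hPd.2).mp e.symm
  have h1 := hE1 _ hv v10 v00 v11
  have : c * b = c * b * (b * c)⁻¹ * (b * c) := by group
  rw [this, h1, one_mul]

/-- An element commuting with an upper-triangular element with distinct diagonal entries and
zero `(0,1)` entry has zero `(0,1)` entry. -/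
theorem offdiag_eq_zero_of_comm_diag {c d : GLm p 2} (hd01 : (d : Mat p 2) 0 1 = 0)
    (hne : (d : Mat p 2) 0 0 ≠ (d : Mat p 2) 1 1) (h : c * d = d * c) :
    (c : Mat p 2) 0 1 = 0 := by
  have e := congrArg (fun g : GLm p 2 => (g : Mat p 2) 0 1) h
  simp only [Units.val_mul, Matrix.mul_apply, Fin.sum_univ_two, hd01, mul_zero, zero_add,
    zero_mul, add_zero] at e
  have e' : (c : Mat p 2) 0 1 * ((d : Mat p 2) 1 1 - (d : Mat p 2) 0 0) = 0 := by
    linear_combination e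
  exact (mul_eq_zero.mp e').resolve_right (sub_ne_zero.mpr hne.symm)

/-- A unitriangular element `[[1,t],[0,1]]` of `GL₂` together with its inverse `[[1,-t],[0,1]]`. -/
theorem exists_unitri (t : ZMod p) :
    ∃ u : GLm p 2, (u : Mat p 2) = !![1, t; 0, 1] ∧
      ((u⁻¹ : GLm p 2) : Mat p 2) = !![1, -t; 0, 1] := by
  have h1 : Matrix.det !![(1 : ZMod p), t; 0, 1] ≠ 0 := by simp [Matrix.det_fin_two_of]
  have h2 : Matrix.det !![(1 : ZMod p), -t; 0, 1] ≠ 0 := by simp [Matrix.det_fin_two_of]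
  refine ⟨Matrix.GeneralLinearGroup.mkOfDetNeZero _ h1, rfl, ?_⟩
  have hmul : Matrix.GeneralLinearGroup.mkOfDetNeZero _ h1 *
      Matrix.GeneralLinearGroup.mkOfDetNeZero _ h2 = 1 := by
    apply Units.ext
    simp [Matrix.GeneralLinearGroup.mkOfDetNeZero, Matrix.one_fin_two]
  rw [inv_eq_of_mul_eq_one_right hmul]
  rfl

/-- Conjugating an upper-triangular `b` by `u = [[1,t],[0,1]]`: the diagonal is kept and the
off-diagonal entry becomes `b₀₁ + t (b₁₁ - b₀₀)`. -/
theorem conj_entries_of_upper {u : GLm p 2} {t : ZMod p} (hu : (u : Mat p 2) = !![1, t; 0, 1])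
    (hu' : ((u⁻¹ : GLm p 2) : Mat p 2) = !![1, -t; 0, 1]) (b : GLm p 2)
    (hb : (b : Mat p 2) 1 0 = 0) :
    ((u * b * u⁻¹ : GLm p 2) : Mat p 2) 1 0 = 0 ∧
    ((u * b * u⁻¹ : GLm p 2) : Mat p 2) 0 0 = (b : Mat p 2) 0 0 ∧
    ((u * b * u⁻¹ : GLm p 2) : Mat p 2) 1 1 = (b : Mat p 2) 1 1 ∧
    ((u * b * u⁻¹ : GLm p 2) : Mat p 2) 0 1 =
      (b : Mat p 2) 0 1 + t * ((b : Mat p 2) 1 1 - (b : Mat p 2) 0 0) := by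
  have e : ((u * b * u⁻¹ : GLm p 2) : Mat p 2) =
      !![(b : Mat p 2) 0 0, (b : Mat p 2) 0 1 + t * ((b : Mat p 2) 1 1 - (b : Mat p 2) 0 0);
        0, (b : Mat p 2) 1 1] := by
    rw [Units.val_mul, Units.val_mul, hu, hu']
    ext i j
    rw [Matrix.mul_apply, Fin.sum_univ_two, Matrix.mul_apply, Matrix.mul_apply, Fin.sum_univ_two,
      Fin.sum_univ_two]
    fin_cases i <;> fin_cases j <;> simp [hb]
    all_goals ring
  rw [e]
  simp

/-- **Borel conjugation.**  An upper-triangular subgroup `E` with no unitriangular element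
except `1` is conjugate by a unitriangular `u = [[1,t],[0,1]]` to a DIAGONAL subgroup. -/
theorem exists_unitri_conj_diag (E : Subgroup (GLm p 2)) (hE : ∀ e ∈ E, (e : Mat p 2) 1 0 = 0)
    (hE1 : ∀ v ∈ E, (v : Mat p 2) 1 0 = 0 → (v : Mat p 2) 0 0 = 1 → (v : Mat p 2) 1 1 = 1 →
      v = 1) :
    ∃ (t : ZMod p) (u : GLm p 2), (u : Mat p 2) = !![1, t; 0, 1] ∧
      ((u⁻¹ : GLm p 2) : Mat p 2) = !![1, -t; 0, 1] ∧
      ∀ e ∈ E, ((u * e * u⁻¹ : GLm p 2) : Mat p 2) 0 1 = 0 ∧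
        ((u * e * u⁻¹ : GLm p 2) : Mat p 2) 1 0 = 0 := by
  by_cases hsc : ∀ b ∈ E, (b : Mat p 2) 0 0 = (b : Mat p 2) 1 1
  · obtain ⟨u, hu, hu'⟩ := exists_unitri (0 : ZMod p)
    refine ⟨0, u, hu, hu', fun e he => ?_⟩
    obtain ⟨e10, -, -, e01⟩ := conj_entries_of_upper hu hu' e (hE e he)
    rw [offdiag_eq_zero_of_eqdiag hE1 he (hE e he) (hsc e he), zero_mul, add_zero] at e01
    exact ⟨e01, e10⟩
  · push Not at hsc
    obtain ⟨b, hb, hne⟩ := hsc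
    have hne' : (b : Mat p 2) 0 0 - (b : Mat p 2) 1 1 ≠ 0 := sub_ne_zero.mpr hne
    obtain ⟨u, hu, hu'⟩ :=
      exists_unitri ((b : Mat p 2) 0 1 * ((b : Mat p 2) 0 0 - (b : Mat p 2) 1 1)⁻¹)
    refine ⟨_, u, hu, hu', fun e he => ?_⟩
    obtain ⟨b10', b00', b11', b01'⟩ := conj_entries_of_upper hu hu' b (hE b hb)
    have hd01 : ((u * b * u⁻¹ : GLm p 2) : Mat p 2) 0 1 = 0 := by
      rw [b01']
      calc (b : Mat p 2) 0 1 + (b : Mat p 2) 0 1 * ((b : Mat p 2) 0 0 - (b : Mat p 2) 1 1)⁻¹ *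
            ((b : Mat p 2) 1 1 - (b : Mat p 2) 0 0)
          = (b : Mat p 2) 0 1 - (b : Mat p 2) 0 1 *
              (((b : Mat p 2) 0 0 - (b : Mat p 2) 1 1)⁻¹ *
                ((b : Mat p 2) 0 0 - (b : Mat p 2) 1 1)) := by
            ring
        _ = 0 := by rw [inv_mul_cancel₀ hne']; ring
    obtain ⟨e10', -, -, -⟩ := conj_entries_of_upper hu hu' e (hE e he)
    have hcomm : (u * e * u⁻¹) * (u * b * u⁻¹) = (u * b * u⁻¹) * (u * e * u⁻¹) := by
      have hc := comm_of_unitri_free hE hE1 he hb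
      calc (u * e * u⁻¹) * (u * b * u⁻¹) = u * (e * b) * u⁻¹ := by group
        _ = u * (b * e) * u⁻¹ := by rw [hc]
        _ = (u * b * u⁻¹) * (u * e * u⁻¹) := by group
    have hne'' : ((u * b * u⁻¹ : GLm p 2) : Mat p 2) 0 0 ≠
        ((u * b * u⁻¹ : GLm p 2) : Mat p 2) 1 1 := by
      rw [b00', b11']; exact hne
    exact ⟨offdiag_eq_zero_of_comm_diag hd01 hne'' hcomm, e10'⟩

end BorelConjugation

end Summit.MatrixMultiplication.MatrixMultiplication.Theorems.SubgroupIdentityDesigns.Negative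

end
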